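import Summits.BirchSwinnertonDyer.BirchSwinnertonDyer.Theorems.SignedLowerHalvesSmallImageLowerHalfBothSignsRttJunctionShaLocCountImai
import Summits.BirchSwinnertonDyer.BirchSwinnertonDyer.Theorems.SignedLowerHalvesSmallImageLowerHalfBothSignsRttJunctionShaNoPthRoot
import HarnessLib

/-!
# Route `SignedLowerHalves`, crux L `SmallImageLowerHalfBothSigns` (stmt-BirchSwinnertonDyer-23599), line `rtt_w3` v30 — stub S3α′ (`stub_junctionShaPT_ns`),
# brick α2-lev (part 7, FINAL ASSEMBLY): S3α′ MINUS `π` with the ONLY remaining input at `vp` = SERRE'S NO-STABLE-LINE for `E[p^∞]` at `vp` (tree currency)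

INPUTS hand `bsd-inputs-honda-p1` g28 under LEAD `cruxlead-stmt-BirchSwinnertonDyer-23599` g14 (cell `bsd-ssimc`); helper `--supports stmt-BirchSwinnertonDyer-23599`. THEOREMS ONLY.
WHAT. `localTowerTorsion_finite_of_noStableLine_of_asIdeal_eq_span` — at a place `v = (p)` (`p` odd) the Imai finiteness of `E(K_{v,∞})[p^∞]` follows IN THE TREE from Serre's no-stable-line
(`IwasawaTowerTorsion.WeierstrassCurve.localTowerTorsionFiniteAt_of_noStableDivisibleLine` + `exists_pTorsion_not_fixed_of_no_primitiveRoot` + part 6′ `not_isPrimitiveRoot_adicCompletion_of_asIdeal_eq_span`);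
★★★ `exists_rhoTwo_finite_of_frameSupp_of_noStableLine` — S3α′ minus `π` (finite `Λ`-module `Loc`, `Λ`-linear `ρ : I₂.H → Loc`, `ker ρ` = the levelwise `Ш²` at `supp(p𝔣)`) from the frame
((R), inertia exponent, `θ`, `θ′·θ₀₀ = 1`, `j` equivariant at `vp` with `𝒪 · range j = ⊤`, `Cofree θ` non-trivial, `vp = (p)` non-split in the tower) and ONE displayed input: Serre 1967 §5 Prop. 8
for `E[p^∞]` at `vp` in the tree's currency (`∀ N ≤ E[p^∞]`, `D_{vp}`-stable, `p`-divisible, `#N[p] ≤ p` ⟹ `N = 0`) — discharged in the tree by `Serre1967.noStableDivisibleLine_of_potentiallySupersingular_holds W p hj hss K vp`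
(`E = W ⊗ K`, `0 ≤ ord_p j(W)`, no unit root above `p`) or by `Serre1967.eq_bot_of_stable_localPoints` (good supersingular reduction of `E` at `vp`) + transport.
HONEST FRAMING: conditional on that one displayed input (and on α5′ for the full S3α′); nothing about S3α′, E2, crux L or BSD is proved; all remain OPEN and are proved for NO curve.
References: [Imai1975] Theorem (p. 12); [Serre1967GroupesPDivisibles] §5 Prop. 8; [GreenbergLNM1716] §3 Lemma 3.3 (p. 87); [NeukirchSchmidtWingberg2008] (8.6.3), (8.6.10).
-/

set_option autoImplicit false
set_option linter.dupNamespace false -- D-0017: single-problem summit, the namespace repeats the problem name by design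
noncomputable section

open scoped Classical
open NumberField IsDedekindDomain Field Function

namespace Summit.BirchSwinnertonDyer.BirchSwinnertonDyer.Theorems.SmallImageRttJunctionSha

open Literature.NumberTheory.EllipticCurves Literature.NumberTheory.GaloisRepresentations
  Literature.NumberTheory.ComplexMultiplication.EllipticUnits.JohnsonLeungKings2011
  WeierstrassCurve

section Vp

variable {K : Type} [Field K] [NumberField K] {p : ℕ} [hp : Fact p.Prime]

/-- **Imai's finiteness at a place `v = (p)`, `p` odd, FROM Serre's no-stable-line** (tree engine + `μ_p ⊄ K_v`). [cite: Imai1975, Theorem (p. 12)] [cite: Serre1967GroupesPDivisibles, §5 Prop. 8]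
[cite: GreenbergLNM1716, §3 Lemma 3.3 (p. 87)] -/
theorem localTowerTorsion_finite_of_noStableLine_of_asIdeal_eq_span (E : WeierstrassCurve K) [E.IsElliptic] (κ : ZpExtension K p) (v : HeightOneSpectrum (𝓞 K))
    (hp2 : p ≠ 2) (hv : v.asIdeal = Ideal.span {((p : ℕ) : 𝓞 K)})
    (hline : ∀ N : AddSubgroup (E.geomPrimaryTorsion p),
      (∀ d ∈ GreenbergSelmer.decomp v, ∀ c ∈ N, d • c ∈ N) → (∀ c ∈ N, ∃ c' ∈ N, p • c' = c) →
        Set.ncard {c : E.geomPrimaryTorsion p | c ∈ N ∧ p • c = 0} ≤ p → N = ⊥) :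
    (FixedPoints.addSubgroup ↥(GreenbergSelmer.decomp v ⊓ κ.kerSubgroup) (E.geomPrimaryTorsion p) : Set (E.geomPrimaryTorsion p)).Finite :=
  IwasawaTowerTorsion.WeierstrassCurve.localTowerTorsionFiniteAt_of_noStableDivisibleLine E p κ v hline
    (IwasawaTowerTorsion.WeierstrassCurve.exists_pTorsion_not_fixed_of_no_primitiveRoot E p κ v
      (not_isPrimitiveRoot_adicCompletion_of_asIdeal_eq_span v hp2 hv))

variable (hp2 : p ≠ 2) {κ : ZpExtension ℚ p} (hK2 : Module.finrank ℚ K = 2)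

/-- ★★★ **S3α′ MINUS `π`, THE `vp`-INPUT REDUCED TO SERRE'S NO-STABLE-LINE AT `vp`** (everything else from the frame). [cite: Serre1967GroupesPDivisibles, §5 Prop. 8] [cite: Imai1975, Theorem (p. 12)]
[cite: NeukirchSchmidtWingberg2008, (8.6.3), (8.6.10)] [cite: PerrinRiou1994Invent, §1.3] -/
theorem exists_rhoTwo_finite_of_frameSupp_of_noStableLine (S : Set (PadicAlgCl p)) [FiniteDimensional ℚ_[p] (padicCoeffField S)]
    (hκ : κ.IsCyclotomic) {γ : absoluteGaloisGroup ℚ} (hγ : κ.IsTopGenerator γ) (hcv : IsCyclotomicVariable p γ)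
    (θ : FramedGaloisRep K (padicCoeffIntegers S) 1) (θ' : absoluteGaloisGroup K →ₜ* (padicCoeffIntegers S)ˣ)
    (hθ'θ : ∀ g : absoluteGaloisGroup K, ((θ' g : (padicCoeffIntegers S)ˣ) : padicCoeffIntegers S) *
      ((θ g : GL (Fin 1) (padicCoeffIntegers S)) : Matrix (Fin 1) (Fin 1) (padicCoeffIntegers S)) 0 0 = 1)
    [Nontrivial (GreenbergSelmer.Cofree θ (padicCoeffField S))]
    (E : WeierstrassCurve K) [E.IsElliptic] (j : E.geomPrimaryTorsion p →+ GreenbergSelmer.Cofree θ (padicCoeffField S))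
    (hj : ∀ v : HeightOneSpectrum (𝓞 K), ((p : ℕ) : 𝓞 K) ∈ v.asIdeal →
      ∀ (δ : absoluteGaloisGroup (v.adicCompletion K)) (t : E.geomPrimaryTorsion p),
        j (resGalOfEmb (closureEmb (K := K) (v.adicCompletion K)) δ • t) = resGalOfEmb (closureEmb (K := K) (v.adicCompletion K)) δ • j t)
    (hjspan : Submodule.span (padicCoeffIntegers S) (Set.range j) = ⊤)
    {𝔣 : Ideal (𝓞 K)} (h𝔣 : 𝔣 ≠ ⊥)
    (hR : ∀ w ∈ suppPF p 𝔣, ((p : ℕ) : 𝓞 K) ∉ w.asIdeal → ∃ 𝔓 ∈ w.primesAbove, ∃ τ ∈ 𝔓.inertia (absoluteGaloisGroup K), θ' τ ≠ 1)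
    {m₀ : ℕ} (hm₀ : m₀ ≠ 0)
    (hθm : ∀ w : HeightOneSpectrum (𝓞 K), ((p : ℕ) : 𝓞 K) ∉ w.asIdeal → ∀ 𝔓 ∈ w.primesAbove, ∀ τ ∈ 𝔓.inertia (absoluteGaloisGroup K), θ' τ ^ m₀ = 1)
    (vp : HeightOneSpectrum (𝓞 K)) (hv : vp.asIdeal = Ideal.span {((p : ℕ) : 𝓞 K)})
    (hns : AcSigned.IsNonsplitIn (κ.restrictOfFinrankEqTwo hp2 K hK2) vp)
    (hline : ∀ N : AddSubgroup (E.geomPrimaryTorsion p),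
      (∀ d ∈ GreenbergSelmer.decomp vp, ∀ c ∈ N, d • c ∈ N) → (∀ c ∈ N, ∃ c' ∈ N, p • c' = c) →
        Set.ncard {c : E.geomPrimaryTorsion p | c ∈ N ∧ p • c = 0} ≤ p → N = ⊥)
    (hNP : ∀ n, ramificationSubgroup K (suppPF p 𝔣) ≤ (κ.restrictOfFinrankEqTwo hp2 K hK2).layerSubgroup n)
    {γK : absoluteGaloisGroup K}
    (I : SmallImageRttD2J1.CycIwasawaCohomologyDataO S (κ.restrictOfFinrankEqTwo hp2 K hK2) γK θ' (suppPF p 𝔣) 2) :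
    letI := I.moduleIwasawa
    ∃ (Loc : Type) (_ : AddCommGroup Loc) (_ : Module (IwasawaAlgebra p) Loc) (_ : Finite Loc) (ρ : I.H →ₗ[IwasawaAlgebra p] Loc),
      ∀ b : I.H, ρ b = 0 ↔ ∀ w ∈ suppPF p 𝔣, ∀ (n k : ℕ) (δ : absoluteGaloisGroup K),
        ContinuousCohomology.map (SmallImageRttD2Seq.locLayerHom (κ.restrictOfFinrankEqTwo hp2 K hK2) (suppPF p 𝔣) w n)
          (SmallImageRttD2Seq.locLayerMod S (κ.restrictOfFinrankEqTwo hp2 K hK2) θ' (suppPF p 𝔣) w n k) 2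
          (SmallImageRttD2J1.cycLayerConjO S (κ.restrictOfFinrankEqTwo hp2 K hK2) θ' (suppPF p 𝔣) n k 2 δ (I.proj n k b)) = 0 := by
  -- every place of `supp(p𝔣)` above `p` IS `vp`
  have huniq : ∀ w : HeightOneSpectrum (𝓞 K), ((p : ℕ) : 𝓞 K) ∈ w.asIdeal → w = vp := by
    intro w hw
    have hle : vp.asIdeal ≤ w.asIdeal := by
      rw [hv, Ideal.span_le, Set.singleton_subset_iff]; exact hw
    exact (HeightOneSpectrum.ext (vp.isMaximal.eq_of_le w.isPrime.ne_top hle)).symm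
  refine exists_rhoTwo_finite_of_frameSupp_of_localTowerTorsionFinite hp2 hK2 S hκ hγ hcv θ θ' hθ'θ E j hj hjspan h𝔣 hR hm₀ hθm (fun w _ hwp ↦ ?_) hNP I
  obtain rfl := huniq w hwp
  exact ⟨hns, hline, localTowerTorsion_finite_of_noStableLine_of_asIdeal_eq_span E (κ.restrictOfFinrankEqTwo hp2 K hK2) w hp2 hv hline⟩

end Vp

end Summit.BirchSwinnertonDyer.BirchSwinnertonDyer.Theorems.SmallImageRttJunctionSha

end
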